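import Mathlib
import Summits.Ventures.PercRepro2.UniversalThetaCert

/-! # (UH*) for `X` in series with a theta-structured network — the theorem
(seat mine-b, cell pub-perc-repro2; MINE-B.md §22.8)

The sums of the certificate of UniversalThetaCert.lean: every statement term is a lower-set statement of `X` on a
slice of a fibre, every containment term is non-negative by the monotonicity of `φ` (the `(0,1)`-fibres are relayed
to their `τ`-images, an injection), and `universal_of_phi` turns the φ-inequality into the private assignment:
**`universal_theta`** — `X` carrying `G_1`, `V2_2` and the level-1 Harris inequality, in series with any
theta-structured `Y`, satisfies (UH*). -/

namespace Summit.Ventures.PercRepro2.UHClosure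

open Finset

variable {X : Type*} [Preorder X] [Fintype X] {Y : Type*} [Preorder Y] [Fintype Y] [DecidableEq Y]
variable (r b : X → ℕ) (ρ β : Y → ℕ)

/-! ### the sums -/

section sums

variable (D : ThetaData ρ β)

omit [Fintype Y] [DecidableEq Y] in
/-- a slice of a fibre is a lower set of `X` -/
lemma tslice_isLowerSet (φ : X × Y → ℕ∞) (hφ : Monotone φ) (y : Y) (m : ℕ∞) :
    IsLowerSet (↑(univ.filter (fun x : X => φ (x, y) ≤ m)) : Set X) := by
  intro x x' hle hx
  simp only [coe_filter, mem_univ, true_and, Set.mem_setOf_eq] at hx ⊢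
  exact (hφ (Prod.mk_le_mk.2 ⟨hle, le_rfl⟩)).trans hx

omit [Fintype Y] [DecidableEq Y] in
/-- a lower-set statement of `X` applied to a slice -/
lemma tslice_nonneg (w : X → ℤ) (hw : ∀ D : Finset X, IsLowerSet (↑D : Set X) → 0 ≤ ∑ x ∈ D, w x)
    (φ : X × Y → ℕ∞) (hφ : Monotone φ) (y : Y) (m : ℕ∞) :
    0 ≤ ∑ x, (if φ (x, y) ≤ m then w x else 0) := by
  rw [← Finset.sum_filter]
  exact hw _ (tslice_isLowerSet φ hφ y m)

omit [Fintype X] [Fintype Y] [DecidableEq Y] in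
/-- a containment: a lower fibre is counted at least as often as a higher one -/
lemma tindL_mono (φ : X × Y → ℕ∞) (hφ : Monotone φ) (x : X) {y y' : Y} (hy : y' ≤ y) (m : ℕ∞) :
    indL (φ (x, y) ≤ m) ≤ indL (φ (x, y') ≤ m) := by
  unfold indL
  have hm : φ (x, y') ≤ φ (x, y) := hφ (Prod.mk_le_mk.2 ⟨le_rfl, hy⟩)
  by_cases h1 : φ (x, y) ≤ m
  · have h2 : φ (x, y') ≤ m := hm.trans h1
    simp only [h1, h2, if_true]; exact le_rfl
  · simp only [h1, if_false]
    split_ifs <;> norm_num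

omit [Fintype X] [Preorder Y] in
/-- an `if y = y₀ ∧ P y` sum over `y` collapses to `y₀` -/
lemma sum_ite_eq_and (y₀ : Y) (P : Y → Prop) [DecidablePred P] (v : ℤ) :
    ∑ y, (if y = y₀ ∧ P y then v else 0) = if P y₀ then v else 0 := by
  classical
  have : ∀ y, (if y = y₀ ∧ P y then v else 0) = if y = y₀ then (if P y then v else 0) else 0 := by
    intro y; by_cases h : y = y₀ <;> simp [h]
  simp only [this, Finset.sum_ite_eq', mem_univ, if_true]

/-- the statement part has non-negative total -/
lemma tsum_certS_nonneg (hG : GDom 1 r b) (hV : VDom 2 r b) (hH : LevelHarris r b)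
    (φ : X × Y → ℕ∞) (hφ : Monotone φ) :
    0 ≤ ∑ x, ∑ y, tcertS ρ β D (r x) (b x) y (φ (x, y)) := by
  have e : ∀ x, ∑ y, tcertS ρ β D (r x) (b x) y (φ (x, y))
      = (if φ (x, D.y00) ≤ 1 then gw 1 (r x) (b x) else 0) + (if φ (x, D.yB) ≤ 2 then vw 2 (r x) (b x) else 0)
        + ∑ y, (if is11 ρ β y ∧ φ (x, y) ≤ 1 then hwOne (r x) (b x) else 0)
        + ∑ y, (if isImg ρ β D y ∧ φ (x, y) ≤ 1 then hwOne (r x) (b x) else 0) := by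
    intro x
    simp only [tcertS, Finset.sum_add_distrib]
    rw [sum_ite_eq_and D.y00 (fun y => φ (x, y) ≤ 1), sum_ite_eq_and D.yB (fun y => φ (x, y) ≤ 2)]
  simp only [e, Finset.sum_add_distrib]
  have h1 := tslice_nonneg (fun x => gw 1 (r x) (b x)) hG φ hφ D.y00 1
  have h2 := tslice_nonneg (fun x => vw 2 (r x) (b x)) hV φ hφ D.yB 2
  have h3 : 0 ≤ ∑ x, ∑ y, (if is11 ρ β y ∧ φ (x, y) ≤ 1 then hwOne (r x) (b x) else 0) := by
    rw [Finset.sum_comm]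
    apply Finset.sum_nonneg
    intro y _
    by_cases hy : is11 ρ β y
    · simp only [hy, true_and]
      exact tslice_nonneg (fun x => hwOne (r x) (b x)) (sum_hwOne_nonneg r b hH) φ hφ y 1
    · simp [hy]
  have h4 : 0 ≤ ∑ x, ∑ y, (if isImg ρ β D y ∧ φ (x, y) ≤ 1 then hwOne (r x) (b x) else 0) := by
    rw [Finset.sum_comm]
    apply Finset.sum_nonneg
    intro y _
    by_cases hy : isImg ρ β D y
    · simp only [hy, true_and]
      exact tslice_nonneg (fun x => hwOne (r x) (b x)) (sum_hwOne_nonneg r b hH) φ hφ y 1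
    · simp [hy]
  linarith

omit [Fintype X] in
/-- the `(0,1)`-containments: the `τ`-images are counted at least as often as the `(0,1)`-fibres -/
lemma tsum_img_ge (φ : X × Y → ℕ∞) (hφ : Monotone φ) (x : X) :
    ∑ y, indL (is01 ρ β y ∧ φ (x, y) ≤ 1) ≤ ∑ y, indL (isImg ρ β D y ∧ φ (x, y) ≤ 1) := by
  classical
  have hl : ∑ y, indL (is01 ρ β y ∧ φ (x, y) ≤ 1) = ∑ y ∈ univ.filter (is01 ρ β), indL (φ (x, y) ≤ 1) := by
    rw [Finset.sum_filter]
    apply Finset.sum_congr rfl; intro y _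
    unfold indL; by_cases h : is01 ρ β y <;> simp [h]
  have hr : ∑ y, indL (isImg ρ β D y ∧ φ (x, y) ≤ 1) = ∑ y ∈ univ.filter (isImg ρ β D), indL (φ (x, y) ≤ 1) := by
    rw [Finset.sum_filter]
    apply Finset.sum_congr rfl; intro y _
    unfold indL; by_cases h : isImg ρ β D y <;> simp [h]
  have himg : (univ.filter (is01 ρ β)).image D.τ = univ.filter (isImg ρ β D) := by
    ext y; simp only [mem_image, mem_filter, mem_univ, true_and, isImg]
  have hinj : Set.InjOn D.τ ↑(univ.filter (is01 ρ β)) := by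
    intro y hy y' hy' he
    simp only [coe_filter, mem_univ, true_and, Set.mem_setOf_eq] at hy hy'
    exact D.hτinj y y' hy.1 hy.2 hy'.1 hy'.2 he
  rw [hl, hr, ← himg, Finset.sum_image hinj]
  apply Finset.sum_le_sum
  intro y hy
  simp only [mem_filter, mem_univ, true_and] at hy
  exact tindL_mono φ hφ x (D.hτ y hy.1 hy.2).1 1

/-- the containment part has non-negative total -/
lemma tsum_certC_nonneg (φ : X × Y → ℕ∞) (hφ : Monotone φ) :
    0 ≤ ∑ x, ∑ y, tcertC ρ β D (r x) (b x) y (φ (x, y)) := by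
  apply Finset.sum_nonneg
  intro x _
  have e : ∑ y, tcertC ρ β D (r x) (b x) y (φ (x, y))
      = mu1 (r x) (b x) * (indL (φ (x, D.y00) ≤ 1) - indL (φ (x, D.t) ≤ 1))
        + mu2 (r x) (b x) * (indL (φ (x, D.yB) ≤ 2) - indL (φ (x, D.t) ≤ 2))
        + mu3 (r x) (b x) * (indL (φ (x, D.yA) ≤ 1) - indL (φ (x, D.t) ≤ 1))
        + mu4 (r x) (b x) * (indL (φ (x, D.yA) ≤ 2) + indL (φ (x, D.yB) ≤ 2) - 2 * indL (φ (x, D.t) ≤ 2))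
        + mu01 (b x) * (∑ y, indL (isImg ρ β D y ∧ φ (x, y) ≤ 1) - ∑ y, indL (is01 ρ β y ∧ φ (x, y) ≤ 1)) := by
    simp only [tcertC, Finset.sum_add_distrib, ← Finset.mul_sum, Finset.sum_sub_distrib, indL]
    rw [sum_ite_eq_and D.y00 (fun y => φ (x, y) ≤ 1), sum_ite_eq_and D.t (fun y => φ (x, y) ≤ 1),
      sum_ite_eq_and D.yB (fun y => φ (x, y) ≤ 2), sum_ite_eq_and D.t (fun y => φ (x, y) ≤ 2),
      sum_ite_eq_and D.yA (fun y => φ (x, y) ≤ 1), sum_ite_eq_and D.yA (fun y => φ (x, y) ≤ 2)]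
  rw [e]
  have i1 := tindL_mono φ hφ x D.h00.2.2 1
  have i2 := tindL_mono φ hφ x D.hB.2.2 2
  have i3 := tindL_mono φ hφ x D.hA.2.2 1
  have i4 := tindL_mono φ hφ x D.hA.2.2 2
  have i5 := tindL_mono φ hφ x D.hB.2.2 2
  have i6 := tsum_img_ge ρ β D φ hφ x
  have m1 : 0 ≤ mu1 (r x) (b x) := by unfold mu1; split_ifs <;> norm_num
  have m2 : 0 ≤ mu2 (r x) (b x) := by unfold mu2; split_ifs <;> norm_num
  have m3 : 0 ≤ mu3 (r x) (b x) := by unfold mu3; split_ifs <;> norm_num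
  have m4 : 0 ≤ mu4 (r x) (b x) := by unfold mu4; split_ifs <;> norm_num
  have m5 : 0 ≤ mu01 (b x) := by unfold mu01; split_ifs <;> norm_num
  nlinarith [mul_nonneg m1 (sub_nonneg.2 i1), mul_nonneg m2 (sub_nonneg.2 i2), mul_nonneg m3 (sub_nonneg.2 i3),
    mul_nonneg m4 (sub_nonneg.2 i4), mul_nonneg m4 (sub_nonneg.2 i5), mul_nonneg m5 (sub_nonneg.2 i6)]

/-- **the φ-inequality of `X` in series with a theta-structured `Y`** -/
theorem phiIneq_theta (D : ThetaData ρ β) (hG : GDom 1 r b) (hV : VDom 2 r b) (hH : LevelHarris r b) :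
    PhiIneq (tR r ρ) (tB b β) := by
  intro φ hφ
  have hsum : ∑ z, (tcertS ρ β D (r z.1) (b z.1) z.2 (φ z) + tcertC ρ β D (r z.1) (b z.1) z.2 (φ z))
      ≤ ∑ z, uw (tR r ρ) (tB b β) z (φ z) := Finset.sum_le_sum (fun z _ => tcert_le r b ρ β D z (φ z))
  have hS := tsum_certS_nonneg r b ρ β D hG hV hH φ hφ
  have hC := tsum_certC_nonneg r b ρ β D φ hφ
  rw [Finset.sum_add_distrib, Fintype.sum_prod_type, Fintype.sum_prod_type] at hsum
  linarith

/-- **THEOREM**: `X` carrying `G_1`, `V2_2` and the level-1 Harris inequality, in series with any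
theta-structured `Y`, satisfies the universal level-conditioned Hall statement (UH*). -/
theorem universal_theta (D : ThetaData ρ β) (hG : GDom 1 r b) (hV : VDom 2 r b) (hH : LevelHarris r b) :
    Universal (tR r ρ) (tB b β) := by
  classical
  exact universal_of_phi (tR r ρ) (tB b β) (phiIneq_theta r b ρ β D hG hV hH)

end sums

end Summit.Ventures.PercRepro2.UHClosure
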